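import Mathlib
import HarnessLib
import Summits.ResolutionOfSingularities.ResolutionOfSingularities.Theorems.RadicandHessianClasses

/-!
# RadicandIsolatedClasses — the ISOLATED rung of the radicand ladder (phase 1 of «IsolatedRadicands»)

ROUTE-INDEPENDENT definitions module (imports only the route-independent `Theorems.RadicandHessianClasses`, p763089) for
the decomp-res node IsolatedRadicands (lens-1 g6 = CHILD NODE of `QuotientModels:27201` over the landed g5 items; source
HOME/decomp-res-lens-1/g6/IsolatedRadicands.lean sha256 f78930fc…, 527 lines; CRITIC-LEDGER row 43 2026-08-30T06:37Z:
CLEARED AS CHILD NODE, critic's `lean check` rc 0 · 0 sorry · 0 warnings).  It hosts the notions the route asides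
`QuotientModels.IsolatedDegenerateRadicands` / `QuotientModels.NonIsolatedRadicands` (the split of the g5 residual
`DegenerateRadicands` 28914 by critical DIMENSION) and the support aside `QuotientModels.ParafactorialDescent` are
stated over:

* `IsolatedIn p N U y g` — every OTHER closed point of the chart `U` is non-critical for `g` (the `s = 0` clause);
* `IsolatedPresentation p N b` — menu A | B | isolated critical point, at every closed point of the proper model `N`;
* `IsolatedClass p k L K` — some generator's radicand has an isolated presentation on some regular proper model of `L`;
  cumulativity `isolatedPresentation_of_rankOne`, `isolatedClass_of_rankOneClass` (rank-one ⊆ isolated);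
* `HypersurfaceCompletion R f` — the `𝔪`-adic completion of the local hypersurface ring `R/(f)` (Mathlib
  `AdicCompletion`).

Everything pointwise (`NonCriticalAt`, `MonomialAt`, `RankOnePresentation`, `RankOneClass`, `sectionToField`) is the
tree's `RadicandHessianClasses`, used BY NAME; nothing re-typed.  Kernels: `Theorems/QuotientModelsIsolatedRadicands.lean`.
[CossartPiltant2019; CossartJannsenSaito2020 Thm. 1.2; hauser2024 p.2]
-/

namespace Summit.ResolutionOfSingularities.ResolutionOfSingularities.Theorems.RadicandIsolatedClasses

open AlgebraicGeometry Literature.AlgebraicGeometry.Resolution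
open Summit.ResolutionOfSingularities.ResolutionOfSingularities.Theorems.RadicandHessianClasses

/-! ## ISOLATED presentations (`s = 0`), over the landed g5 vocabulary -/

section Isolated

variable {k L : Type} [Field k] [Field L] [Algebra k L]

/-- «Every OTHER closed point of the chart is non-critical» — the isolatedness clause (`s = 0`),
literally the clause already inside `HyperbolicPresentation` / `RankOnePresentation`. -/
def IsolatedIn (p : ℕ) (N : ProperModel.{0} k L) (U : N.X.Opens) (y : N.X) (g : Γ(N.X, U)) :
    Prop :=
  ∀ (y' : N.X) (hy' : y' ∈ U), IsClosed ({y'} : Set N.X) → y' ≠ y →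
    NonCriticalAt p ((N.X.presheaf.germ U y' hy').hom g)

/-- ISOLATED PRESENTATION (menu A | B | any critical point that is ISOLATED in its chart). -/
def IsolatedPresentation (p : ℕ) (N : ProperModel.{0} k L) (b : L) : Prop :=
  ∀ y : N.X, IsClosed ({y} : Set N.X) →
    ∃ (U : N.X.Opens) (hy : y ∈ U) (g : Γ(N.X, U)) (s : L), s ≠ 0 ∧
      sectionToField N U hy g = b * s ^ p ∧
      (NonCriticalAt p ((N.X.presheaf.germ U y hy).hom g) ∨
       MonomialAt p ((N.X.presheaf.germ U y hy).hom g) ∨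
       IsolatedIn p N U y g)

/-- Cumulativity: rank-one ⇒ isolated presentation (forget the rank). -/
theorem isolatedPresentation_of_rankOne {p : ℕ} {N : ProperModel.{0} k L} {b : L}
    (h : RankOnePresentation p N b) : IsolatedPresentation p N b := by
  intro y hyc
  obtain ⟨U, hy, g, s, hs, hg, hmenu⟩ := h y hyc
  refine ⟨U, hy, g, s, hs, hg, ?_⟩
  rcases hmenu with hA | hB | ⟨-, hiso⟩
  · exact Or.inl hA
  · exact Or.inr (Or.inl hB)
  · exact Or.inr (Or.inr hiso)

end Isolated

section Classes

variable (p : ℕ) (k L K : Type) [Field k] [Field L] [Field K] [Algebra k L] [Algebra L K]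

/-- `K/L` is in the ISOLATED class (some generator's radicand has a presentation on some regular
proper model of `L` all of whose critical points are non-critical, pure monomial, or isolated). -/
def IsolatedClass : Prop :=
  ∃ (a' : K) (b' : L), IntermediateField.adjoin L ({a'} : Set K) = ⊤ ∧
    algebraMap L K b' = a' ^ p ∧
    ∃ N : ProperModel.{0} k L, Scheme.IsRegular N.X ∧ IsolatedPresentation p N b'

variable {p k L K} in
/-- Cumulativity of the classes: rank-one ⊆ isolated. -/
theorem isolatedClass_of_rankOneClass (h : RankOneClass p k L K) : IsolatedClass p k L K := by
  obtain ⟨a', b', htop, hb, N, hN, hpres⟩ := h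
  exact ⟨a', b', htop, hb, N, hN, isolatedPresentation_of_rankOne hpres⟩

end Classes

/-! ## Completion of a local hypersurface ring -/

/-- The `𝔪`-adic completion `Â` of the local hypersurface ring `A = R/(f)` (Mathlib's
`AdicCompletion` along the image of `𝔪_R`; helper for `ParafactorialDescent`). -/
abbrev HypersurfaceCompletion (R : Type) [CommRing R] [IsLocalRing R] (f : R) : Type :=
  AdicCompletion ((IsLocalRing.maximalIdeal R).map (Ideal.Quotient.mk (Ideal.span {f})))
    (R ⧸ Ideal.span {f})

end Summit.ResolutionOfSingularities.ResolutionOfSingularities.Theorems.RadicandIsolatedClasses
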